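/-
rh-split cell (screw), width seat 2 on line L22 (route-RiemannHypothesis-ScrewQuarticNodes, desk
rh-idea-9), 2026-08-27.  Kernel bookkeeping for the route's DECLARED RESIDUAL: with the door
`SparseNodeDoor` proved (stmt-22169), the residual `QuarticNodePositivity` (stmt-22170) is
RH-EQUIVALENT given the provable-now support `QuarticNodesDense` — it is nobody's proving target and
RH is not proved by this; nothing here bears on the truth of RH.
-/
import Summits.RiemannHypothesis.RiemannHypothesis.Theorems.ScrewQuarticNodesSparseNodeDoor
import Literature.NumberTheory.LFunctions.ZetaScrewThm17Proofs
import HarnessLib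

/-!
# Route ScrewQuarticNodes (L22) — the declared residual `QuarticNodePositivity` is RH-equivalent
# (supports item stmt-RiemannHypothesis-22170)

`Ψ = zetaScrew` (Suzuki2023 (1.1)).  The route file declares `QuarticNodePositivity` (`Ψ(4·log j) ≥ 0`
for every integer `j ≥ 1`, i.e. non-negativity of Suzuki's screw function at the quartic nodes
`x = j⁴`) to be «RH-EQUIVALENT·DERIVED: ⟸ RH (Suzuki2023 Thm 1.7); ⟹ RH by SparseNodeDoor +
QuarticNodesDense».  This file makes both arrows kernel facts:

* `quarticNodePositivity_of_RH : RH → QuarticNodePositivity` (tree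
  `ZetaScrewThm17.zetaScrew_nonneg_of_RH`, Suzuki2023 Thm 1.7: `Ψ ≥ 0` everywhere under RH);
* `rh_of_quarticNodePositivity : QuarticNodesDense → QuarticNodePositivity → RH` — the PROVED door
  (`ScrewQuarticNodesSparseNodeDoor.sparseNodeDoor_proof`, stmt-22169) fed into the route's deciding
  theorem `Theses.ScrewQuarticNodes.closes`;
* `quarticNodePositivity_iff_rh : QuarticNodesDense → (QuarticNodePositivity ↔ RH)`;
* `zetaScrew_quartic_node_neg_of_zero` — the ASSUME-THE-OPPOSITE portrait of the line as a theorem: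
  given `QuarticNodesDense`, ONE zero `s` of `ζ` with `1/2 < Re s < 1` forces a quartic node with
  `Ψ(4·log j) < 0` (indeed one with `Ψ(4·log j) < −K` for every `K > 0`: `exists_quartic_node_lt`).

`QuarticNodesDense` (stmt-22171, elementary real analysis: the gaps `4·log(1 + 1/j) ≤ 4e^{−a/4}` of
the quartic nodes beat the Nyquist gap `√(100/(e^{(a+2)/2}+1))`) is kept as a HYPOTHESIS here — it is
a separate support item of the route with its own closer.  So the route is complete modulo a
conjunct that is RH itself in kernel-checked clothes: honest bookkeeping, 0 summit credit.  RH is not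
proved by this; nothing here bears on the truth of RH.
-/

-- D-0017: `Summit.RiemannHypothesis.RiemannHypothesis.…` duplicates the namespace BY DESIGN (single-problem summit).
set_option linter.dupNamespace false

noncomputable section

open Set

namespace Summit.RiemannHypothesis.RiemannHypothesis.Theorems.ScrewQuarticNodes

open Literature.NumberTheory.LFunctions
open Summit.RiemannHypothesis.RiemannHypothesis.Theses.ScrewQuarticNodes

/-- **RH ⟹ `QuarticNodePositivity`** (the easy arrow): under RH, `Ψ ≥ 0` everywhere (Suzuki2023
Thm 1.7, tree `ZetaScrewThm17.zetaScrew_nonneg_of_RH`), in particular at the quartic nodes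
`4·log j`. -/
theorem quarticNodePositivity_of_RH (hRH : _root_.RiemannHypothesis) : QuarticNodePositivity :=
  fun _ _ => ZetaScrewThm17.zetaScrew_nonneg_of_RH hRH _

/-- **`QuarticNodesDense → QuarticNodePositivity → RH`**: the door `SparseNodeDoor` is PROVED
(`ScrewQuarticNodesSparseNodeDoor.sparseNodeDoor_proof`, stmt-22169), so the route's deciding
theorem `closes` turns density + node positivity into RH.  (This is why the residual is nobody's
proving target.)  RH is not proved by this. -/
theorem rh_of_quarticNodePositivity (hN : QuarticNodesDense) (hR : QuarticNodePositivity) :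
    _root_.RiemannHypothesis :=
  closes ScrewQuarticNodesSparseNodeDoor.sparseNodeDoor_proof hN hR

/-- **The declared residual of route ScrewQuarticNodes is RH-equivalent given the density support**
(kernel bookkeeping for stmt-RiemannHypothesis-22170): `QuarticNodesDense → (QuarticNodePositivity ↔
RH)`.  RH is not proved by this. -/
theorem quarticNodePositivity_iff_rh (hN : QuarticNodesDense) :
    QuarticNodePositivity ↔ _root_.RiemannHypothesis :=
  ⟨rh_of_quarticNodePositivity hN, quarticNodePositivity_of_RH⟩

/-- **Deep negative quartic nodes off RH.**  Given the density support, if RH fails then for every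
`K > 0` some quartic node carries `Ψ(4·log j) < −K`: otherwise `Ψ ≥ −K` on the quartic node set and
the proved door (at this `K`, on the node set `{4·log j}` — dense enough for `K ≥ 100`, and for
smaller `K` the node bound `Ψ ≥ −K ≥ −100` feeds the door at `K = 100`) would give RH. -/
theorem exists_quartic_node_lt (hN : QuarticNodesDense) (hRH : ¬ _root_.RiemannHypothesis)
    {K : ℝ} (hK : 0 < K) :
    ∃ j : ℕ, 1 ≤ j ∧ zetaScrew (4 * Real.log j) < -K := by
  by_contra h
  push Not at h
  apply hRH
  -- node bounds `Ψ(4 log j) ≥ -K ≥ -max K 100`, door at `K₁ = max K 100 ≥ 100`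
  set K₁ : ℝ := max K 100 with hK₁
  have hK₁K : K ≤ K₁ := le_max_left _ _
  have hK₁100 : (100 : ℝ) ≤ K₁ := le_max_right _ _
  refine ScrewQuarticNodesSparseNodeDoor.sparseNodeDoor K₁ {x : ℝ | ∃ j : ℕ, 1 ≤ j ∧ x = 4 * Real.log j}
    (by positivity) ?_ ?_
  · obtain ⟨T₀, hT⟩ := hN
    refine ⟨T₀, fun a ha => ?_⟩
    obtain ⟨j, hj, h1, h2⟩ := hT a ha
    refine ⟨4 * Real.log j, ⟨j, hj, rfl⟩, h1, h2.trans ?_⟩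
    gcongr
  · rintro x ⟨j, hj, rfl⟩
    have := h j hj
    linarith

/-- **The minimal-counterexample portrait as a theorem** (contrapositive of the proved door, given
the density support): a zero `s` of `ζ` with `1/2 < Re s < 1` forces a NEGATIVE quartic node,
`Ψ(4·log j) < 0` for some `j ≥ 1` — the refutation-budget object of the residual. -/
theorem zetaScrew_quartic_node_neg_of_zero (hN : QuarticNodesDense) {s : ℂ}
    (hs : riemannZeta s = 0) (h₁ : 1 / 2 < s.re) (h₂ : s.re < 1) :
    ∃ j : ℕ, 1 ≤ j ∧ zetaScrew (4 * Real.log j) < 0 := by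
  have hRH : ¬ _root_.RiemannHypothesis := fun hRH =>
    quasiRiemannHypothesis_one_half_iff_holds.2 hRH s hs h₁ h₂
  obtain ⟨j, hj, hlt⟩ := exists_quartic_node_lt hN hRH one_pos
  exact ⟨j, hj, by linarith⟩

end Summit.RiemannHypothesis.RiemannHypothesis.Theorems.ScrewQuarticNodes

end
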